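import Summits.Ventures.LatticeQCDFlow.Exactness.FreeFieldFlowTauIntVolumeLaw
import Summits.Ventures.LatticeQCDFlow.Exactness.FlowAcceptanceOverlap
import HarnessLib

/-!
# The free-field volume law of the flow arm's ACCEPTANCE: for a product Gaussian flow on `V` Gaussian
# modes, `(Π_k r_k)² ≤ ā ≤ Π_k √(2r_k/(1 + r_k²)) ≤ exp(−¼ Σ_k (1 − r_k)²)`, `r_k` the width ratio

HONEST FRAMING: exact (Metropolis-corrected) sampling algorithms for lattice gauge theory;
figures of merit are autocorrelation/cost numbers at stated couplings and volumes; no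
continuum-physics claim.  (SCALAR calibration rung S0-A: not a gauge result.)

Venture `LatticeQCDFlow` (cell pub-lqcd), topic `Exactness`; FANOUT row 2 (`s0-phi4`, FLOW arm; the
battery's free-field limit).  NEW WORK of the cell — the ACCEPTANCE companion of row 2's
`Scoring/FreeFieldFlowESS` (reweighting efficiency of a Gaussian model of a Gaussian mode in closed
form, with its two-sided volume law) and `FreeFieldFlowTauIntVolumeLaw` (`τ_int` ceiling), composed
from row 2's `FlowAcceptanceOverlap` (`m² ≤ ā ≤ m`, `m = ∫ min(P, Q)` on a general space),
`gaussProd_facts` (product Gaussian densities on `ℝ^ι`) and Mathlib (`integral_gaussian`,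
`integral_fintype_prod_volume_eq_prod`).  Nothing is cited as a fact; no definition.  Printed
counterparts NAMED ONLY: Abbott et al. 2022 (arXiv:2211.07541 §V: acceptance/ESS fall exponentially
with the volume at fixed model quality), Del Debbio–Marsh Rossney–Wilson 2021; in the tree the
finite-space volume laws are theory-2's / row 3's `Scaling/AcceptanceVolume*`, `Scaling/KLVolumeLawPi`,
`Scaling/AcceptanceBhattacharyyaFloor` (`acc ≤ BC²` there is for the PAIR law; here the plain
`ā ≤ m ≤ BC` suffices).

SETTING.  Target `P = ⊗_k N(0, s_k)`, model `Q = ⊗_k N(0, t_k)` on `ℝ^ι` (all variances `≠ 0`), both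
as densities against Lebesgue measure; `ā = ∫∫ min(P(x)Q(y), P(y)Q(x))` the exact flow sampler's
equilibrium acceptance (`FlowAcceptanceOverlap`'s form); `r_k = √(min(s_k,t_k)/max(s_k,t_k)) ∈ (0, 1]`
the width ratio of mode `k` (either way round).

## What is proved

* §1 (one mode, `s, t ≠ 0`): `gaussMode_density_mul`, `gaussMode_sqrt_density_mul`,
  **`gaussMode_bhattacharyya`** — the Bhattacharyya coefficient of two centred Gaussians in
  closed form, `∫ √(p_s p_t) = √(2√(st)/(s+t))` (`= √(2r/(1+r²))`);
  **`gaussMode_overlap_ge_ratio`** — the overlap floor `∫ min(p_s, p_t) ≥ r` (the narrower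
  density times `r` lies below both); `gaussMode_integrable_sqrt_density_mul`.
* §2 (`ι` finite): **`freeFieldFlow_meanAccept_le_bhattacharyya`** —
  `ā ≤ Π_k √(2√(s_k t_k)/(s_k + t_k))` (`ā ≤ ∫ min(P,Q) ≤ ∫ √(PQ)`, which factorises);
  **`freeFieldFlow_meanAccept_ge_prod_ratio_sq`** — `(Π_k r_k)² ≤ ā` (`min` of products ≥ product of
  `min`s, Fubini, `m² ≤ ā`); `bhattacharyya_factor_le_exp` — `√(2√(st)/(s+t)) ≤ exp(−(1 − r)²/4)`
  (`2r/(1+r²) ≤ 1 − (1−r)²/2 ≤ e^{−(1−r)²/2}`); **`freeFieldFlow_meanAccept_le_exp`** —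
  `ā ≤ exp(−¼ Σ_k (1 − r_k)²)`.

Reading for S0-A (no numerics implied): at the free-field point the flow arm's acceptance column
obeys an explicit two-sided VOLUME LAW in the per-mode width errors — it cannot fall faster than
`(Π r_k)²` nor stay above `exp(−¼ Σ (1−r_k)²)`; with a uniform per-mode error `r_k = r < 1` this is
`r^{2V} ≤ ā_V ≤ e^{−V(1−r)²/4}`: exponential decay in the volume unless the per-mode width error
shrinks like `V^{−1/2}`, the same threshold as the ESS law of `FreeFieldFlowESS`.  The one-mode exact
value `(4/π)·arctan r` is the companion file `GaussianFlowModeAcceptance`.  NOT CLAIMED: `λ > 0`;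
non-diagonal or non-Gaussian flows; any value for a trained network; sharpness of either side for
`V ≥ 2`.
-/

namespace Summit.Ventures.LatticeQCDFlow.Exactness

open Real MeasureTheory ProbabilityTheory Filter Set
open scoped NNReal

/-! ## §1 One mode: the Bhattacharyya coefficient of two centred Gaussians, and an overlap floor -/

section OneMode

variable {s t : ℝ≥0}

/-- `√(2πs)·√(2πt) = 2π√(st)`. -/
private theorem sqrt_two_pi_mul_mul (s t : ℝ≥0) :
    Real.sqrt (2 * π * s) * Real.sqrt (2 * π * t) = 2 * π * Real.sqrt ((s : ℝ) * t) := by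
  rw [← Real.sqrt_mul (by positivity), show 2 * π * (s : ℝ) * (2 * π * t) = (2 * π) ^ 2 * (s * t) by ring,
    Real.sqrt_mul (by positivity), Real.sqrt_sq (by positivity)]

/-- The product of the two densities: `p_s(x) p_t(x) = (2π√(st))⁻¹ · exp(−x²(s+t)/(2st))`. -/
theorem gaussMode_density_mul (hs : s ≠ 0) (ht : t ≠ 0) (x : ℝ) :
    gaussianPDFReal 0 s x * gaussianPDFReal 0 t x
      = (2 * π * Real.sqrt ((s : ℝ) * t))⁻¹ * Real.exp (-(((s : ℝ) + t) / (2 * s * t) * x ^ 2)) := by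
  have hs' : (s : ℝ) ≠ 0 := NNReal.coe_ne_zero.mpr hs
  have ht' : (t : ℝ) ≠ 0 := NNReal.coe_ne_zero.mpr ht
  simp only [gaussianPDFReal_def, sub_zero]
  rw [mul_mul_mul_comm, ← mul_inv, sqrt_two_pi_mul_mul, ← Real.exp_add]
  congr 2
  field_simp
  ring

/-- Its square root: `√(p_s p_t)(x) = (√(2π√(st)))⁻¹ · exp(−x²(s+t)/(4st))`. -/
theorem gaussMode_sqrt_density_mul (hs : s ≠ 0) (ht : t ≠ 0) (x : ℝ) :
    Real.sqrt (gaussianPDFReal 0 s x * gaussianPDFReal 0 t x)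
      = (Real.sqrt (2 * π * Real.sqrt ((s : ℝ) * t)))⁻¹
        * Real.exp (-(((s : ℝ) + t) / (4 * s * t) * x ^ 2)) := by
  rw [gaussMode_density_mul hs ht, Real.sqrt_mul (by positivity), Real.sqrt_inv,
    show -(((s : ℝ) + t) / (4 * s * t) * x ^ 2) = -(((s : ℝ) + t) / (2 * s * t) * x ^ 2) / 2 by ring,
    Real.exp_half]

/-- **THE BHATTACHARYYA COEFFICIENT OF TWO CENTRED GAUSSIANS**:
`∫ √(p_s p_t) = √(2√(st)/(s + t))` (`= √(2r/(1 + r²))` with `r` the width ratio). -/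
theorem gaussMode_bhattacharyya (hs : s ≠ 0) (ht : t ≠ 0) :
    ∫ x, Real.sqrt (gaussianPDFReal 0 s x * gaussianPDFReal 0 t x)
      = Real.sqrt (2 * Real.sqrt ((s : ℝ) * t) / (s + t)) := by
  have hs' : (0 : ℝ) < s := by exact_mod_cast pos_iff_ne_zero.mpr hs
  have ht' : (0 : ℝ) < t := by exact_mod_cast pos_iff_ne_zero.mpr ht
  have hst : 0 < Real.sqrt ((s : ℝ) * t) := Real.sqrt_pos.mpr (by positivity)
  have hb : 0 < ((s : ℝ) + t) / (4 * s * t) := by positivity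
  simp_rw [gaussMode_sqrt_density_mul hs ht, ← neg_mul]
  rw [integral_const_mul, integral_gaussian, ← Real.sqrt_inv, ← Real.sqrt_mul (by positivity)]
  congr 1
  have h2 : Real.sqrt ((s : ℝ) * t) ^ 2 = s * t := Real.sq_sqrt (by positivity)
  field_simp
  nlinarith [h2, hst]

/-- **The overlap floor**: `∫ min(p_s, p_t) ≥ √(min(s,t)/max(s,t))` — the narrower density times
the width ratio sits below both. -/
theorem gaussMode_overlap_ge_ratio (hs : s ≠ 0) (ht : t ≠ 0) :
    Real.sqrt (min (s : ℝ) t / max (s : ℝ) t)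
      ≤ ∫ x, min (gaussianPDFReal 0 s x) (gaussianPDFReal 0 t x) := by
  -- by symmetry assume `t ≤ s`
  wlog hts : (t : ℝ) ≤ s generalizing s t
  · have h := this ht hs (le_of_not_ge hts)
    rw [min_comm, max_comm] at h
    simpa only [min_comm] using h
  have hs' : (0 : ℝ) < s := by exact_mod_cast pos_iff_ne_zero.mpr hs
  have ht' : (0 : ℝ) < t := by exact_mod_cast pos_iff_ne_zero.mpr ht
  rw [min_eq_right hts, max_eq_left hts]
  set r : ℝ := Real.sqrt ((t : ℝ) / s) with hr
  have hr0 : 0 ≤ r := Real.sqrt_nonneg _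
  have hr1 : r ≤ 1 := by rw [hr, Real.sqrt_le_one]; exact (div_le_one hs').mpr hts
  -- pointwise: `r · p_t ≤ min(p_s, p_t)`
  have hpt : ∀ x, r * gaussianPDFReal 0 t x ≤ min (gaussianPDFReal 0 s x) (gaussianPDFReal 0 t x) := by
    intro x
    refine le_min ?_ (mul_le_of_le_one_left (gaussianPDFReal_nonneg _ _ _) hr1)
    simp only [gaussianPDFReal_def, sub_zero]
    have hc : r * (Real.sqrt (2 * π * t))⁻¹ = (Real.sqrt (2 * π * s))⁻¹ := by
      rw [hr, ← Real.sqrt_inv, ← Real.sqrt_inv, ← Real.sqrt_mul (div_nonneg ht'.le hs'.le)]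
      congr 1
      field_simp
    rw [← mul_assoc, hc]
    refine mul_le_mul_of_nonneg_left (Real.exp_le_exp.mpr ?_) (inv_nonneg.mpr (Real.sqrt_nonneg _))
    rw [neg_div, neg_div, neg_le_neg_iff]
    exact div_le_div_of_nonneg_left (sq_nonneg x) (by positivity) (by linarith)
  calc r = ∫ x, r * gaussianPDFReal 0 t x := by
        rw [integral_const_mul, integral_gaussianPDFReal_eq_one 0 ht, mul_one]
    _ ≤ ∫ x, min (gaussianPDFReal 0 s x) (gaussianPDFReal 0 t x) :=
        integral_mono ((integrable_gaussianPDFReal 0 t).const_mul r)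
          ((integrable_gaussianPDFReal 0 s).inf (integrable_gaussianPDFReal 0 t)) hpt

/-- `√(p_s p_t)` is integrable (a Gaussian). -/
theorem gaussMode_integrable_sqrt_density_mul (hs : s ≠ 0) (ht : t ≠ 0) :
    Integrable (fun x => Real.sqrt (gaussianPDFReal 0 s x * gaussianPDFReal 0 t x)) := by
  have hs' : (0 : ℝ) < s := by exact_mod_cast pos_iff_ne_zero.mpr hs
  have ht' : (0 : ℝ) < t := by exact_mod_cast pos_iff_ne_zero.mpr ht
  have hb : 0 < ((s : ℝ) + t) / (4 * s * t) := by positivity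
  simp_rw [gaussMode_sqrt_density_mul hs ht, ← neg_mul]
  exact (integrable_exp_neg_mul_sq hb).const_mul _

end OneMode

/-! ## §2 `V` independent modes: the two-sided volume law -/

section Product

variable {ι : Type*} [Fintype ι]

/-- `√(Π f) = Π √f` for nonnegative factors. -/
private theorem sqrt_prod_eq_prod_sqrt {f : ι → ℝ} (hf : ∀ i, 0 ≤ f i) :
    Real.sqrt (∏ i, f i) = ∏ i, Real.sqrt (f i) := by
  classical
  refine Finset.induction_on (Finset.univ : Finset ι) (by simp) (fun a S ha ih => ?_)
  rw [Finset.prod_insert ha, Finset.prod_insert ha, Real.sqrt_mul (hf a), ih]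

/-- `min(a, b) ≤ √(ab)` for `a, b ≥ 0`. -/
private theorem min_le_sqrt_mul {a b : ℝ} (ha : 0 ≤ a) (hb : 0 ≤ b) : min a b ≤ Real.sqrt (a * b) := by
  have hm : 0 ≤ min a b := le_min ha hb
  rw [← Real.sqrt_sq hm, sq]
  exact Real.sqrt_le_sqrt (mul_le_mul (min_le_left a b) (min_le_right a b) hm ha)

/-- `Π min(aᵢ, bᵢ) ≤ min(Π aᵢ, Π bᵢ)` for nonnegative factors. -/
private theorem prod_min_le_min_prod {a b : ι → ℝ} (ha : ∀ i, 0 ≤ a i) (hb : ∀ i, 0 ≤ b i) :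
    ∏ i, min (a i) (b i) ≤ min (∏ i, a i) (∏ i, b i) :=
  le_min (Finset.prod_le_prod (fun i _ => le_min (ha i) (hb i)) fun _ _ => min_le_left _ _)
    (Finset.prod_le_prod (fun i _ => le_min (ha i) (hb i)) fun _ _ => min_le_right _ _)

/-- **CEILING — THE ACCEPTANCE OF A PRODUCT GAUSSIAN FLOW DECAYS LIKE THE BHATTACHARYYA PRODUCT**:
target `⊗_k N(0, s_k)`, model `⊗_k N(0, t_k)` on `ℝ^ι` (all variances `≠ 0`); the exact flow
sampler's equilibrium acceptance `ā = ∫∫ min(P(x)Q(y), P(y)Q(x))` satisfies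
`ā ≤ Π_k √(2√(s_k t_k)/(s_k + t_k))` (`= Π_k √(2r_k/(1 + r_k²))`, `r_k` the width ratio of mode `k`). -/
theorem freeFieldFlow_meanAccept_le_bhattacharyya (s t : ι → ℝ≥0) (hs : ∀ i, s i ≠ 0)
    (ht : ∀ i, t i ≠ 0) :
    ∫ x : ι → ℝ, ∫ y : ι → ℝ, min ((∏ i, gaussianPDFReal 0 (s i) (x i)) * ∏ i, gaussianPDFReal 0 (t i) (y i))
        ((∏ i, gaussianPDFReal 0 (s i) (y i)) * ∏ i, gaussianPDFReal 0 (t i) (x i))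
      ≤ ∏ i, Real.sqrt (2 * Real.sqrt ((s i : ℝ) * t i) / (s i + t i)) := by
  obtain ⟨hp0, hpm, hpi, hp1⟩ := gaussProd_facts s hs
  obtain ⟨hq0, hqm, hqi, hq1⟩ := gaussProd_facts t ht
  have h1 := meanAccept_le_overlap (μ := (volume : Measure (ι → ℝ))) (fun x => (hp0 x).le) hpm hpi hp1
    (fun x => (hq0 x).le) hqm hqi hq1
  refine h1.trans ?_
  -- `∫ min(P, Q) ≤ ∫ √(PQ) = Π_k BC_k`
  have hsq : ∀ x : ι → ℝ, Real.sqrt ((∏ i, gaussianPDFReal 0 (s i) (x i)) * ∏ i, gaussianPDFReal 0 (t i) (x i))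
      = ∏ i, Real.sqrt (gaussianPDFReal 0 (s i) (x i) * gaussianPDFReal 0 (t i) (x i)) := by
    intro x
    rw [← Finset.prod_mul_distrib]
    exact sqrt_prod_eq_prod_sqrt fun i => mul_nonneg (gaussianPDFReal_nonneg _ _ _)
      (gaussianPDFReal_nonneg _ _ _)
  have hint : Integrable (fun x : ι → ℝ =>
      ∏ i, Real.sqrt (gaussianPDFReal 0 (s i) (x i) * gaussianPDFReal 0 (t i) (x i))) := by
    have h := Integrable.fintype_prod (𝕜 := ℝ) (μ := fun _ : ι => (volume : Measure ℝ))
      (f := fun i x => Real.sqrt (gaussianPDFReal 0 (s i) x * gaussianPDFReal 0 (t i) x))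
      fun i => gaussMode_integrable_sqrt_density_mul (hs i) (ht i)
    rw [← volume_pi] at h
    exact h
  calc ∫ x : ι → ℝ, min (∏ i, gaussianPDFReal 0 (s i) (x i)) (∏ i, gaussianPDFReal 0 (t i) (x i))
      ≤ ∫ x : ι → ℝ, ∏ i, Real.sqrt (gaussianPDFReal 0 (s i) (x i) * gaussianPDFReal 0 (t i) (x i)) := by
        refine integral_mono (hpi.inf hqi) hint fun x => ?_
        dsimp only
        rw [← hsq x]
        exact min_le_sqrt_mul (hp0 x).le (hq0 x).le
    _ = ∏ i, ∫ x, Real.sqrt (gaussianPDFReal 0 (s i) x * gaussianPDFReal 0 (t i) x) :=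
        integral_fintype_prod_volume_eq_prod
          (f := fun i x => Real.sqrt (gaussianPDFReal 0 (s i) x * gaussianPDFReal 0 (t i) x))
    _ = ∏ i, Real.sqrt (2 * Real.sqrt ((s i : ℝ) * t i) / (s i + t i)) :=
        Finset.prod_congr rfl fun i _ => gaussMode_bhattacharyya (hs i) (ht i)

/-- **FLOOR — THE SQUARED PRODUCT OF WIDTH RATIOS**: in the same setting,
`(Π_k √(min(s_k,t_k)/max(s_k,t_k)))² ≤ ā` (the overlap of the products is at least the product of
the one-mode overlaps, each at least the width ratio, and `m² ≤ ā`). -/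
theorem freeFieldFlow_meanAccept_ge_prod_ratio_sq (s t : ι → ℝ≥0) (hs : ∀ i, s i ≠ 0)
    (ht : ∀ i, t i ≠ 0) :
    (∏ i, Real.sqrt (min (s i : ℝ) (t i) / max (s i : ℝ) (t i))) ^ 2
      ≤ ∫ x : ι → ℝ, ∫ y : ι → ℝ, min ((∏ i, gaussianPDFReal 0 (s i) (x i)) * ∏ i, gaussianPDFReal 0 (t i) (y i))
        ((∏ i, gaussianPDFReal 0 (s i) (y i)) * ∏ i, gaussianPDFReal 0 (t i) (x i)) := by
  obtain ⟨hp0, hpm, hpi, hp1⟩ := gaussProd_facts s hs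
  obtain ⟨hq0, hqm, hqi, hq1⟩ := gaussProd_facts t ht
  have h1 := overlap_sq_le_meanAccept (μ := (volume : Measure (ι → ℝ))) (fun x => (hp0 x).le) hpm hpi
    (fun x => (hq0 x).le) hqm hqi hq1
  refine le_trans ?_ h1
  have hr0 : 0 ≤ ∏ i, Real.sqrt (min (s i : ℝ) (t i) / max (s i : ℝ) (t i)) :=
    Finset.prod_nonneg fun i _ => Real.sqrt_nonneg _
  refine pow_le_pow_left₀ hr0 ?_ 2
  -- `Π r_k ≤ Π ∫ min(p_k, q_k) = ∫ Π min(p_k, q_k) ≤ ∫ min(P, Q)`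
  have hint : Integrable (fun x : ι → ℝ =>
      ∏ i, min (gaussianPDFReal 0 (s i) (x i)) (gaussianPDFReal 0 (t i) (x i))) := by
    have h := Integrable.fintype_prod (𝕜 := ℝ) (μ := fun _ : ι => (volume : Measure ℝ))
      (f := fun i x => min (gaussianPDFReal 0 (s i) x) (gaussianPDFReal 0 (t i) x))
      fun i => (integrable_gaussianPDFReal 0 (s i)).inf (integrable_gaussianPDFReal 0 (t i))
    rw [← volume_pi] at h
    exact h
  calc ∏ i, Real.sqrt (min (s i : ℝ) (t i) / max (s i : ℝ) (t i))
      ≤ ∏ i, ∫ x, min (gaussianPDFReal 0 (s i) x) (gaussianPDFReal 0 (t i) x) :=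
        Finset.prod_le_prod (fun i _ => Real.sqrt_nonneg _)
          fun i _ => gaussMode_overlap_ge_ratio (hs i) (ht i)
    _ = ∫ x : ι → ℝ, ∏ i, min (gaussianPDFReal 0 (s i) (x i)) (gaussianPDFReal 0 (t i) (x i)) :=
        (integral_fintype_prod_volume_eq_prod
          (f := fun i x => min (gaussianPDFReal 0 (s i) x) (gaussianPDFReal 0 (t i) x))).symm
    _ ≤ ∫ x : ι → ℝ, min (∏ i, gaussianPDFReal 0 (s i) (x i)) (∏ i, gaussianPDFReal 0 (t i) (x i)) :=
        integral_mono hint (hpi.inf hqi) fun x =>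
          prod_min_le_min_prod (fun i => gaussianPDFReal_nonneg _ _ _) fun i => gaussianPDFReal_nonneg _ _ _

/-- **One Bhattacharyya factor in the width ratio**: `2√(st)/(s+t) = 2r/(1+r²)` with
`r = √(min(s,t)/max(s,t))`, and `2r/(1+r²) ≤ 1 − (1−r)²/2`, so each mis-sized mode costs a factor at
most `√(1 − (1−r_k)²/2) ≤ exp(−(1−r_k)²/4)` — exponential decay of the acceptance in the number of
mis-sized modes at fixed per-mode width error. -/
theorem bhattacharyya_factor_le_exp {s t : ℝ≥0} (hs : s ≠ 0) (ht : t ≠ 0) :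
    Real.sqrt (2 * Real.sqrt ((s : ℝ) * t) / (s + t))
      ≤ Real.exp (-(1 - Real.sqrt (min (s : ℝ) t / max (s : ℝ) t)) ^ 2 / 4) := by
  -- reduce to `t ≤ s` by symmetry
  wlog hts : (t : ℝ) ≤ s generalizing s t
  · have h := this ht hs (le_of_not_ge hts)
    rw [min_comm, max_comm, show ((t : ℝ) * s) = s * t from mul_comm _ _, add_comm] at h
    exact h
  have hs' : (0 : ℝ) < s := by exact_mod_cast pos_iff_ne_zero.mpr hs
  have ht' : (0 : ℝ) < t := by exact_mod_cast pos_iff_ne_zero.mpr ht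
  rw [min_eq_right hts, max_eq_left hts]
  set r : ℝ := Real.sqrt ((t : ℝ) / s) with hr
  have hr0 : 0 < r := Real.sqrt_pos.mpr (div_pos ht' hs')
  have hr1 : r ≤ 1 := by rw [hr, Real.sqrt_le_one]; exact (div_le_one hs').mpr hts
  -- `2√(st)/(s+t) = 2r/(1+r²)`
  have hrs : r * Real.sqrt s = Real.sqrt t := by
    rw [hr, ← Real.sqrt_mul (div_nonneg ht'.le hs'.le), div_mul_cancel₀ _ hs'.ne']
  have hr2 : r ^ 2 = t / s := by rw [hr, Real.sq_sqrt (div_nonneg ht'.le hs'.le)]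
  have hkey : 2 * Real.sqrt ((s : ℝ) * t) / (s + t) = 2 * r / (1 + r ^ 2) := by
    rw [Real.sqrt_mul hs'.le, ← hrs, hr2]
    have hS : Real.sqrt (s : ℝ) ^ 2 = s := Real.sq_sqrt hs'.le
    field_simp
    nlinarith [hS]
  rw [hkey]
  -- `2r/(1+r²) ≤ 1 − (1−r)²/2 ≤ (exp(−(1−r)²/4))²`
  have hle : 2 * r / (1 + r ^ 2) ≤ 1 - (1 - r) ^ 2 / 2 := by
    rw [div_le_iff₀ (by positivity)]
    -- `(1 − u²/2)(1 + (1−u)²) − 2(1−u) = u³(1 − u/2) ≥ 0`, `u = 1 − r ∈ [0, 1]`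
    have key : 0 ≤ (1 - r) ^ 3 * (1 - (1 - r) / 2) :=
      mul_nonneg (pow_nonneg (sub_nonneg.mpr hr1) 3) (by linarith)
    nlinarith [key]
  have hexp : 1 - (1 - r) ^ 2 / 2 ≤ Real.exp (-(1 - r) ^ 2 / 4) ^ 2 := by
    rw [← Real.exp_nat_mul]
    have := Real.add_one_le_exp (-(1 - r) ^ 2 / 2)
    push_cast at *
    rw [show (2 : ℝ) * (-(1 - r) ^ 2 / 4) = -(1 - r) ^ 2 / 2 by ring]
    linarith
  calc Real.sqrt (2 * r / (1 + r ^ 2)) ≤ Real.sqrt (Real.exp (-(1 - r) ^ 2 / 4) ^ 2) :=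
        Real.sqrt_le_sqrt (hle.trans hexp)
    _ = Real.exp (-(1 - r) ^ 2 / 4) := Real.sqrt_sq (Real.exp_pos _).le

/-- **THE VOLUME LAW, EXPONENTIAL FORM**: `ā ≤ exp(−¼ Σ_k (1 − r_k)²)`, `r_k = √(min(s_k,t_k)/max(s_k,t_k))`. -/
theorem freeFieldFlow_meanAccept_le_exp (s t : ι → ℝ≥0) (hs : ∀ i, s i ≠ 0) (ht : ∀ i, t i ≠ 0) :
    ∫ x : ι → ℝ, ∫ y : ι → ℝ, min ((∏ i, gaussianPDFReal 0 (s i) (x i)) * ∏ i, gaussianPDFReal 0 (t i) (y i))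
        ((∏ i, gaussianPDFReal 0 (s i) (y i)) * ∏ i, gaussianPDFReal 0 (t i) (x i))
      ≤ Real.exp (-(∑ i, (1 - Real.sqrt (min (s i : ℝ) (t i) / max (s i : ℝ) (t i))) ^ 2) / 4) := by
  refine (freeFieldFlow_meanAccept_le_bhattacharyya s t hs ht).trans ?_
  rw [show -(∑ i, (1 - Real.sqrt (min (s i : ℝ) (t i) / max (s i : ℝ) (t i))) ^ 2) / 4
      = ∑ i, (-(1 - Real.sqrt (min (s i : ℝ) (t i) / max (s i : ℝ) (t i))) ^ 2 / 4) by
    rw [← Finset.sum_div, ← Finset.sum_neg_distrib], Real.exp_sum]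
  exact Finset.prod_le_prod (fun i _ => Real.sqrt_nonneg _) fun i _ => bhattacharyya_factor_le_exp (hs i) (ht i)

end Product

end Summit.Ventures.LatticeQCDFlow.Exactness
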